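import Mathlib
import HarnessLib
import HarnessLib.Audit
import Summits.CriticalPhenomena.Statement
import Literature.Probability.Percolation.CriticalContinuityProofs
import Literature.Probability.Percolation.KestenTheoremProofs

/-!
Route: PercExchangeRateTransport

# Route PercExchangeRateTransport — jumps ride the characteristics — exchange-rate convergence makes
the critical jump a curve invariant, and Kesten–Harris at the planar end of ℤ²×ℤ empties it at ℤ³

It suffices to show X = K⁺ ∧ K⁻ (card exchange-rate-transport, its K1 split by side): embed bond
percolation on ℤ³ as the
ISOTROPIC INTERIOR POINT t = p of the two-parameter family on ℤ²×ℤ (labels U_e i.i.d. uniform; an x-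
or y-bond is open iff
U_e ≤ p, a z-bond iff U_e ≤ t), with box one-arm polynomials Θ_n(p,t) = P(0 ↔ ∂Λ_n), θ(p,t) = inf_n
Θ_n, critical curve
p_c(t) = inf{p : θ(p,t) > 0} and critical jump J(t) := θ(p_c(t),t). K⁺
(SupercritExchangeUniformity): on the closed
supercritical collar {p_c(t) ≤ p ≤ p_c(t)+ρ} of every compact sub-arc t ∈ [lo,hi] ⊂ (0,1) the
finite-volume EXCHANGE RATE
∂_tΘ_n/∂_pΘ_n converges uniformly in n to a field a⁺ continuous up to the curve and Lipschitz in p.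
K⁻ (SubcritExchangeUniformity):
from BELOW the curve the finite-volume exchange rate converges to a continuous function σ(t) of the
curve point, uniformly as
n → ∞ AND p_c(t) − p → 0 together (a δ(η)-strip, not a fixed collar: deep in the subcritical collar
the limit of a_n jumps across
the diagonal t = p by FACE SELECTION — the cheapest face of Λ_n wins — by an amount O(dist to the
curve), so no fixed-collar uniform
statement can hold there; this typing is the planner's repair of the card's K1). Both hypotheses
contain the critical curve itself,
i.e. the critical window, where they force a⁺(p_c(t),t) = σ(t). Given X, the TRANSPORT STEP (cruxes
TransportLemma — abstract, real analysis — and CurveInvariance, its instantiation)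
makes J constant on every compact sub-arc; the planar anchor J(t) → 0 as t ↓ 0 (usc at (p_c(ℤ²),0) +
the PROVED tree theorem
`PercolationContinuity 2` = `percolationContinuity_two kesten_criticalProb_Z2_holds
harris_theta_half_holds`) then forces
J ≡ 0, and the diagonal point t = p = p_c(ℤ³) lies on the curve, so θ_{ℤ³}(p_c) = J(p_c(ℤ³)) = 0.
Lean: `(let μ := Literature.Probability.Percolation.labelMeasure
(Literature.Probability.LatticeModels.Site 3); let vert : Sym2
(Literature.Probability.LatticeModels.Site 3) → Prop := fun e => ∃ x :
Literature.Probability.LatticeModels.Site 3, e = s(x, x + Pi.single (2 : Fin 3) 1); let cfg : ℝ → ℝ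
→ (Sym2 (Literature.Probability.LatticeModels.Site 3) → ℝ) → Set (Sym2
(Literature.Probability.LatticeModels.Site 3)) := fun p t U => {e | e ∈
(Literature.Probability.LatticeModels.zdGraph 3).edgeSet ∧ ((vert e ∧ U e ≤ t) ∨ (¬ vert e ∧ U e ≤
p))}; let Θ : ℕ → ℝ → ℝ → ℝ := fun n p t => μ.real {U | cfg p t U ∈
Literature.Probability.Percolation.siteToBoundary 3 n}; let θ : ℝ → ℝ → ℝ := fun p t => μ.real {U |
cfg p t U ∈ Literature.Probability.Percolation.percolatesAt (0 :
Literature.Probability.LatticeModels.Site 3)}; let pc : ℝ → ℝ := fun t => sInf ({p : ℝ | 0 ≤ p ∧ p ≤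
1 ∧ 0 < θ p t} ∪ {1}); ∀ lo hi : ℝ, 0 < lo → lo < hi → hi < 1 → ∃ ρ > (0 : ℝ), ∃ L : ℝ, ∃ a : ℝ → ℝ
→ ℝ, ContinuousOn (fun x : ℝ × ℝ => a x.1 x.2) {x : ℝ × ℝ | x.2 ∈ Set.Icc lo hi ∧ pc x.2 ≤ x.1 ∧ x.1
≤ pc x.2 + ρ} ∧ (∀ t ∈ Set.Icc lo hi, ∀ p q : ℝ, pc t ≤ p → p ≤ pc t + ρ → pc t ≤ q → q ≤ pc t + ρ →
|a p t - a q t| ≤ L * |p - q|) ∧ ∀ η > (0 : ℝ), ∃ m : ℕ, ∀ n ≥ m, ∀ t ∈ Set.Icc lo hi, ∀ p : ℝ, pc t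
≤ p → p ≤ pc t + ρ → |deriv (fun s => Θ n p s) t - a p t * deriv (fun q => Θ n q t) p| ≤ η * deriv
(fun q => Θ n q t) p) ∧ (let μ := Literature.Probability.Percolation.labelMeasure
(Literature.Probability.LatticeModels.Site 3); let vert : Sym2
(Literature.Probability.LatticeModels.Site 3) → Prop := fun e => ∃ x :
Literature.Probability.LatticeModels.Site 3, e = s(x, x + Pi.single (2 : Fin 3) 1); let cfg : ℝ → ℝ
→ (Sym2 (Literature.Probability.LatticeModels.Site 3) → ℝ) → Set (Sym2
(Literature.Probability.LatticeModels.Site 3)) := fun p t U => {e | e ∈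
(Literature.Probability.LatticeModels.zdGraph 3).edgeSet ∧ ((vert e ∧ U e ≤ t) ∨ (¬ vert e ∧ U e ≤
p))}; let Θ : ℕ → ℝ → ℝ → ℝ := fun n p t => μ.real {U | cfg p t U ∈
Literature.Probability.Percolation.siteToBoundary 3 n}; let θ : ℝ → ℝ → ℝ := fun p t => μ.real {U |
cfg p t U ∈ Literature.Probability.Percolation.percolatesAt (0 :
Literature.Probability.LatticeModels.Site 3)}; let pc : ℝ → ℝ := fun t => sInf ({p : ℝ | 0 ≤ p ∧ p ≤
1 ∧ 0 < θ p t} ∪ {1}); ∀ lo hi : ℝ, 0 < lo → lo < hi → hi < 1 → ∃ σ : ℝ → ℝ, ContinuousOn σ (Set.Icc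
lo hi) ∧ ∀ η > (0 : ℝ), ∃ δ > (0 : ℝ), ∃ m : ℕ, ∀ n ≥ m, ∀ t ∈ Set.Icc lo hi, ∀ p : ℝ, pc t - δ ≤ p
→ p ≤ pc t → |deriv (fun s => Θ n p s) t - σ t * deriv (fun q => Θ n q t) p| ≤ η * deriv (fun q => Θ
n q t) p)`

## Assembly
The deciding theorem is CRUX-ONLY (D-0027 §2.1; rev 8, route-repair 2026-08-16, gate stamp
`glue.non-crux-hypothesis` cleared):
`closes (hSup : SupercritExchangeUniformity) (hSub : SubcritExchangeUniformity) (hT :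
TransportLemma) (hMF : ModelFacts)
(hCC : CriticalCurveRegular) (hCI : CurveInvariance) : PercolationContinuityZ3` — six crux binders,
all used; ≈ 190 lines,
sorry-free, axioms propext/Classical.choice/Quot.sound (planner Scratch3.lean rc 0 against the live
route module; native
`#h21_check_closes` ok, non_crux []). Part (I) is a percolation-free real-variable core over
abstract Θ, θ = inf_n Θ_n, p_c, th3,
th2: (A) t ≤ p_c(t) for t < p₃ := p_c(ℤ³) and (B) p_c(t) ≤ p₃ for t > p₃ (order arguments on the
sInf defining p_c, using
θ(p,p) = θ_{ℤ³}(p), θ = 0 below / θ > 0 above p_c); (C) p_c(p₃) = p₃ by continuity of the curve at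
p₃ (CriticalCurveRegular), so
J(p₃) = θ_{ℤ³}(p_c); (AV) J(t) → 0 as t ↓ 0 by upper semicontinuity of inf_n Θ_n at (p_c(ℤ²), 0) and
θ(p,0) = θ_{ℤ²}(p) — the
content of the support items DiagonalOnCurve and AnchorVanishing, proved inside `closes`; then, if
J(p₃) > 0, CurveInvariance (fed
TransportLemma, K⁺, K⁻, ModelFacts, CriticalCurveRegular and the tree theorem 0 < p_c < 1) on
[lo,hi] = [lo, (p₃+1)/2] gives
J(p₃) = J(hi) = J(lo) < J(p₃)/2, contradiction, and J ≥ 0. Part (II) instantiates by unification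
with the items' `let`s and
invokes the tree theorems `Grimmett1999_criticalProb_pos_lt_one_holds` (0 < p_c(ℤ^d) < 1 at d = 2,
3),
`percolationContinuity_two kesten_criticalProb_Z2_holds harris_theta_half_holds` (θ_{ℤ²}(p_c) = 0),
`theta_eq_zero_of_lt_criticalProb_holds`, `theta_pos_of_criticalProb_lt_holds` (route imports
CriticalContinuityProofs,
KestenTheoremProofs; the cone has 0 unproved deps). Residue of the repair, inert and outside the
cone of `closes`: the supports
PlanarAnchor, PcBounds (one-liners from the tree theorems), AnchorVanishing, DiagonalOnCurve (now
inside `closes`), the rank-4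
support CurveInvariance-variant `CurveTransport` (stmt-16270, renders as a TODO: it names rank-9
decls declared after it), the
rank-1 Assembly (old ten-binder type, now a corollary of `closes`) and the stray second assembly
Assembly2 (stmt-16164) — assembly
items can be neither dropped nor re-badged by a planner and `route.multi-assembly` blocks
add/restate/drop until the gate's
multi-assembly autofix retires Assembly2; a tenure pass then drops the residue.

Rationale: WHY THIS LINE. Mechanism (card exchange-rate-transport): by Russo, ∂_tΘ_n and ∂_pΘ_n are pivotal
intensities of z-bonds and of x,y-bonds,
so their ratio a_n is a bounded LOCAL statistic (AizenmanGrimmett1991, BalisterBollobasRiordan2014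
give 0 < c ≤ a_n ≤ C,
whence only a Lipschitz critical curve, ChayesSchonmann2000 Thm 1.4); if a_n CONVERGES uniformly on
a two-sided collar, the
chain rule makes every Θ_n, n ≥ m(η), monotone along the η-tilted characteristics ṗ = −(a ± η) of
the limiting field, θ = inf_n Θ_n
inherits this, zero-propagation from the subcritical side and positivity-propagation from the
supercritical side pin the curve
(p_c ∈ C¹, p_c′ = −a∘curve: a Clausius–Clapeyron relation), and Euler polygons + a discrete Grönwall
step (Lipschitz-in-p of a⁺
only) carry the jump: J(t₁) ≤ θ(p_c(t₀)+ε, t₀) → J(t₀) by right-continuity of θ(·,t₀) at a FIXED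
level — the price sprinkling
pays in p is paid by upper semicontinuity, exactly once, at the planar end. Imported areas:
first-order transport PDE /
characteristics (real analysis, Mathlib ODE-free), two-parameter Russo calculus
(AizenmanGrimmett1991), finite-size scaling
heuristics for why K± should hold (Wegner/Aharony–Fisher analytic scaling fields: every regime
measures the same slope,
a_n → −p_c′(t) + O(dist), doi:10.1103/PhysRevB.27.4394; 2D ratio-limit prototype
GarbanPeteSchramm2013Pivotal §4.5). Typing subtlety
found and repaired here: below the curve the O(dist) correction is DISCONTINUOUS across the diagonal
t = p (Θ_n ~ e^{−n·min(m_xy,m_z)}, the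
cheapest face wins, and ∂_t m_xy/∂_p m_xy ≠ ∂_t m_z/∂_p m_z off the curve), so a uniform limit on a
fixed subcritical collar cannot exist
(uniform limits of continuous functions are continuous); K⁻ is therefore localised to a δ(η)-strip,
which is all the pinching step uses,
while the supercritical side (Θ_n → θ smooth, corrections exponentially small) keeps the fixed
collar the Grönwall step needs.
What it does that prior routes do not: the three deformation routes on this conjunct
(PercDiodeSteering, PercLupuEnvironment,
PercLongRangeCatalyst) put ℤ³ at the DEGENERATE END of a solved family and need endpoint-uniform
control (conjunct-equivalent there);
here ℤ³ is an interior point of the arc, the solved model (ℤ², Harris–Kesten) sits at the far end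
where usc alone suffices, and the
transported object is a RATIO of two intractable intensities, not a value. Negatives index (10
statements, 3 on this sub: TiltGluing,
CoverIsCovering, QuarantineInequality) untouched: no item is a crossing/gluing/quarantine
inequality.

RANKED CRUXES. #2 SupercritExchangeUniformity (crux) — K⁺ — for every compact sub-arc [lo,hi] ⊂
(0,1) there are ρ > 0, L and a field a⁺, continuous on the closed supercritical collar {t ∈ [lo,hi],
p_c(t) ≤ p ≤ p_c(t)+ρ} and L-Lipschitz in p there, such that for every η > 0 and all n ≥ m(η):
|∂_tΘ_n − a⁺ ∂_pΘ_n| ≤ η ∂_pΘ_n on that collar (uniform convergence of the finite-volume exchange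
rate, critical window included; card K1, supercritical half + its regularity). [difficulty:
open-problem] (why it might fail: it is a ratio-limit theorem for pivotal intensities UNIFORM
through the critical window from above, with no RSW/quasi-multiplicativity in 3D; it may be as hard
as the conjunct, and a jump world would put its fan exactly here.) [GarbanPeteSchramm2013Pivotal,
AizenmanGrimmett1991, ChayesSchonmann2000, GeorgakopoulosPanagiotis2019,
doi:10.1103/PhysRevB.27.4394, arXiv:1706.07495]
#3 SubcritExchangeUniformity (crux) — K⁻ — for every compact sub-arc [lo,hi] ⊂ (0,1) there is a
continuous σ : [lo,hi] → ℝ (the slope the subcritical phase measures; K⁺ ∧ K⁻ force σ(t) =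
a⁺(p_c(t),t) = −p_c′(t)) such that for every η > 0 there are δ > 0 and m with |∂_tΘ_n(p,t) − σ(t)
∂_pΘ_n(p,t)| ≤ η ∂_pΘ_n(p,t) whenever n ≥ m, t ∈ [lo,hi] and p_c(t) − δ ≤ p ≤ p_c(t) (card K1,
subcritical half, LOCALISED to a δ(η)-strip: it only pins the slope of the curve, so neither a field
off the curve nor a Lipschitz clause is asked for). [difficulty: open-problem] (why it might fail:
needs the window ratio limit from below AND that the crossover to the Ornstein–Zernike string regime
deviates from σ(t) by o(1) as p↑p_c(t) uniformly in n (face selection makes the deviation O(dist),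
direction-dependent); unproved even in d=2.) [CampaninoIoffeVelenik2008,
GarbanPeteSchramm2013Pivotal, AizenmanGrimmett1991, Grimmett1999, arXiv:0712.3412]
#5 TransportLemma (crux; ledger rank 9 after the retriage, a binder of `closes`) — the abstract
transport lemma (real analysis, percolation-free): for C¹ functions Θ_n on the open unit square,
nondecreasing in p and t, nonincreasing in n, nonnegative, with Θ_∞ = inf_n Θ_n having a continuous
threshold curve pc on [lo,hi] ⊂ (0,1) whose ρ-collar lies inside the square, a field a continuous on
the two-sided ρ-collar and L-Lipschitz in p on its right half, and for every η > 0 the exchange-rate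
inequality |∂_tΘ_n − a ∂_pΘ_n| ≤ η ∂_pΘ_n for n ≥ m(η) on {p_c(t) − δ(η) ≤ p ≤ p_c(t) + ρ} (full
right collar, δ(η)-strip on the left): then t ↦ Θ_∞(pc t, t) is constant on [lo,hi]. Proof =
pinching (pc ∈ C¹, pc′ = −a∘curve) + Euler polygons with slopes a(vertex) ± η + discrete Grönwall +
right-continuity of Θ_∞(·,t) at fixed t (NOTES.md §Transport proof). [difficulty: M] (why it might
fail: only AS TYPED — an abstract ∀-statement over (Θ, pc, a) can hide a quantifier or junk-value
slip (one was caught before open: levels t outside (0,1) make `deriv` vacuous); the mathematics is a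
three-page Euler-polygon + discrete-Grönwall argument.) [card:exchange-rate-transport, Grimmett1999,
ChayesSchonmann2000]
#6 CriticalCurveRegular (crux; ledger rank 9, binder of `closes`) — the anisotropic critical curve t
↦ p_c(t) is continuous on (0,1) with 0 < p_c(t) < 1 (two-sided Aizenman–Grimmett comparability c
∂_pΘ_n ≤ ∂_tΘ_n ≤ C ∂_pΘ_n on compacts of the open square gives local Lipschitz continuity exactly
as in Chayes–Schonmann's mixed site–bond curve; p_c(t) ≥ (1−t)/8 by path counting with vertical
runs, p_c(t) ≤ p_c(ℤ²) < 1 by monotonicity in t). [difficulty: L] (why it might fail: continuity of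
the anisotropic critical curve on all of (0,1) is Aizenman–Grimmett folklore, not in print for this
family; the comparability constants degenerate as t → 1 (columns of length 1/(1−t)), so local
Lipschitz bounds must be re-derived scale by scale there.) [ChayesSchonmann2000,
AizenmanGrimmett1991, BalisterBollobasRiordan2014, arXiv:1706.07495, Grimmett1999]
#7 ModelFacts (crux; ledger rank 9, binder of `closes`) — bookkeeping for the label-coupled
anisotropic family: each Θ_n is continuous on ℝ², C¹ (indeed polynomial) on the open square,
nondecreasing in p and in t, nonincreasing in n, valued in [0,1]; θ = inf_n Θ_n (continuity from
above: ∩_n {0 ↔ ∂Λ_n in Λ_n} = {|C(0)| = ∞}); ∂_pΘ_n > 0 on the open square for n ≥ 1 (Russo: the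
straight x-path is pivotal); the diagonal t = p is bond percolation on ℤ³
(`map_configOfLabels_holds`) and t = 0 is a.s. bond percolation on the plane ℤ² × {0}. [difficulty:
L] (why it might fail: only as typed: `Measure.real` of the label events (measurability must be
shown, not assumed), strict positivity of ∂_pΘ_n needs n ≥ 1 and the open square, and the planar end
is an a.s. identification (U_e ≤ 0 has probability 0) — standard but unformalised.) [Grimmett1999,
Literature.Probability.Percolation.map_configOfLabels,
Literature.Probability.Percolation.siteToBoundary,
Literature.Probability.Percolation.ProdBernoulliRusso]
#9 PlanarAnchor (support; RESIDUE since rev 8 — discharged inside `closes` by the tree theorem,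
outside its cone) — θ_{ℤ²}(p_c(ℤ²)) = 0 (Harris 1960 + Kesten 1980); in tree as
`percolationContinuity_two` modulo the named facts `kesten_criticalProb_Z2`, `harris_theta_half`.
[difficulty: XL] [Harris1960, KestenCMP1980, Grimmett1999]
#9 PcBounds (support; RESIDUE since rev 8 — `Grimmett1999_criticalProb_pos_lt_one_holds` is used
inside `closes`) — 0 < p_c(ℤ^d) < 1 for d ≥ 2 (Peierls + tree bound); the Literature named fact,
used at d = 2 and d = 3 to place the planar anchor and the diagonal point inside the open square.
[difficulty: M] [Grimmett1999,
Literature.Probability.Percolation.Grimmett1999_criticalProb_pos_lt_one]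
#9 CurveInvariance (crux since rev 7: the sixth binder of `closes`; with TransportLemma it is the
transport step) — instantiation: TransportLemma + K⁺ + K⁻ + ModelFacts + CriticalCurveRegular + (0 <
p_c < 1, proved in tree) ⇒ J is constant on every compact sub-arc [lo,hi] ⊂ (0,1) (extend a⁺ below
the curve by σ(t); the glued field is continuous because K⁺ and K⁻ both hold at p = p_c(t) and
∂_pΘ_n > 0 forces a⁺(p_c(t),t) = σ(t); shrink ρ into the open square; threshold property of p_c from
its sInf definition and θ = inf_n Θ_n). [difficulty: M] (why it might fail: Instantiation as typed:
the glued field a := a⁺ above / σ(t) below the curve is continuous only where ∂_pΘ_n > 0 for some n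
≥ m(η); K±'s collar and δ(η)-strip must fit TransportLemma's two-sided ρ-collar after shrinking ρ on
[lo,hi]; the threshold property is needed for all real p (sInf ∪ {1}).)
[card:exchange-rate-transport, ChayesSchonmann2000, Grimmett1999]
#9 AnchorVanishing (support; RESIDUE since rev 8 — proved inside `closes`, part (I)(AV)) — the free
anchor: ModelFacts + PcBounds + PercolationContinuity 2 ⇒ J(t) → 0 as t ↓ 0 (p_c(t) ≤ p_c(ℤ²) by
monotonicity in t; θ(p_c(ℤ²),t) = inf_n Θ_n(p_c(ℤ²),t) and Θ_n(p_c(ℤ²),0) ↓ θ_{ℤ²}(p_c(ℤ²)) = 0, so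
usc in t at the planar point does the rest — no uniformity near the planar end is used).
[difficulty: M] [Harris1960, KestenCMP1980, arXiv:1706.07495, Grimmett1999]
#9 DiagonalOnCurve (support; RESIDUE since rev 8 — proved inside `closes`, part (I)(A)–(C)) — the
isotropic point is ON the curve: ModelFacts + CriticalCurveRegular + PcBounds ⇒ p_c(t)|_{t =
p_c(ℤ³)} = p_c(ℤ³) and J(p_c(ℤ³)) = θ_{ℤ³}(p_c) (order argument: p_c(t) ≥ t for t < p_c(ℤ³), ≤ t for
t > p_c(ℤ³), continuity of the curve at p_c(ℤ³) ∈ (0,1)). [difficulty: M] [Grimmett1999,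
AizenmanGrimmett1991]

TWO-LAYER PLAN. Foreseen glued splits, filed only after a crux moves (k ≤ 3, depth 1):
SupercritExchangeUniformity ⇐ WindowRatioLimit (a_n(p,t) → a
uniformly on {|p − p_c(t)| ≤ K n^{-1/ν′}} for some ν′ — the shared critical-window ratio-limit
theorem) → SupercritOffWindow
(uniform convergence and Lipschitz regularity on {p_c(t) + K n^{-1/ν′} ≤ p ≤ p_c(t)+ρ} from
Kesten–Zhang/Grimmett–Marstrand
renormalisation at scale ξ plus Georgakopoulos–Panagiotis analyticity of θ in two parameters) →
SupercritExchangeUniformity;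
SubcritExchangeUniformity ⇐ WindowRatioLimit (shared) → SubcritOffWindow (Ornstein–Zernike renewal
structure of the conditioned
subcritical cluster, CampaninoIoffeVelenik2008, giving a_n → ∂_tφ/∂_pφ with φ the inverse
correlation length of the cheapest
direction) → SubcritExchangeUniformity.

KILL CRITERIA. ¬SupercritExchangeUniformity or ¬SubcritExchangeUniformity PROVED (e.g. an
unconditional oscillation of the window exchange
rate, or a proof that continuity of the limit across the window fails in every world) closes the
route `refuted:<Decl>`; a proof
that K⁻ fails while K⁺ survives ⇒ pivot (new route) to the one-sided version whose second crux is
the Clausius–Clapeyron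
relation p_c ∈ C¹, p_c′ = −a⁺∘curve; Monte-Carlo evidence that window profiles of a_n do NOT flatten
with n on the anisotropic
arc (card jobs j004389 ff., or the cheapest falsifier below) retires the line as physically false
even before a proof. A misstatement
in TransportLemma / ModelFacts / CriticalCurveRegular is repaired, not fatal (real analysis /
bookkeeping / Aizenman–Grimmett).
Mooted if any route proves θ_{ℤ³}(p_c) = 0 directly; conversely a jump would locate its 'fan' on the
arc and refute K⁺ there.

NOT DECOMPOSED YET. The window/off-window split of K± (layer 2 above); the exact size of the
face-selection jump of lim a_n across the diagonal below the
curve (a computable Ornstein–Zernike quantity, ∂_t m/∂_p m longitudinal vs transverse) as a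
stand-alone Literature lemma; the volume-event variant Θ_n = P(|C(0)| ≥ n) (no face selection, same
transport lemma) kept in reserve if box events misbehave deep in the subcritical collar; the Osgood
(u log 1/u) refinement of the
transport lemma needed for the card's FK arc q ∈ [1,2] (exponents vary with q) and the one-sided
catalyst-corner instance (card
K2, K3) — separate future routes sharing TransportLemma; the identification a(p_c(t),t) = −p_c′(t) =
1/2 at the isotropic
point (cubic symmetry) as a stand-alone check; constants ρ, L, m(η).

CHEAPEST FALSIFIER. Monte Carlo on ℤ²×ℤ at one anisotropy, t = 0.15: locate p_c(0.15) by Binder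
crossing, then measure the window profile
x ↦ a_n(p_c(t) + x n^{-1/ν}, t) = E[N_z; A_n fails]/E[N_xy; A_n fails] (closed pivotal counts for
A_n = {0 ↔ ∂Λ_n}) for
n = 8, 16, 32, 48 and x ∈ [−2, 3]: K± demand that the profiles FLATTEN to a common constant with
amplitude ~ n^{-ω}, and
that at the isotropic point the off-diagonal germ (E[N_z]/E[N_xy] − 1/2)/(t − p) converges in n; a
persistent O(1)
x-dependence or a drifting germ kills the line (the card's jobs j004389–j004532 test exactly this;
unread from this seat).
Structural falsifier already applied by the planner: 'uniform limit of continuous a_n must be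
continuous' kills any fixed-collar
subcritical statement via face selection — K⁻ as filed survives it by localisation; refuters should
re-run it against K⁺ (is
lim_n a_n continuous on a FIXED supercritical collar? yes iff ∂Θ_n → ∂θ there, θ smooth across the
diagonal). Lookup falsifier run today: Kesten1982 pp. 43–53 ('critical surface') treats only planar
periodic graphs — no transport
statement in print to make the route `known`.

NUMBERS. p_c(ℤ³, bond) = 0.2488126(5), p_c(ℤ², bond) = 1/2 (KestenCMP1980); a ≡ 1/2 on the diagonal
t = p for every n (cubic
symmetry: z-bonds are one third of the bonds), so K± predict p_c′(t) = −1/2 at t = p_c(ℤ³); 3D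
percolation 1/ν = 1.141(2),
correction-to-scaling ω ≈ 1.2–1.6 (arXiv:1302.0421), hence νω > 1: the analytic-scaling-field
prediction for the limit field is
a(p,t) = −p_c′(t) + O(|p − p_c(t)|) (Lipschitz, no Osgood needed on the Bernoulli arc), finite-size
deviation a_n − a = O(n^{-ω});
planar end: p_c(t) → 1/2 with crossover exponent ψ = γ(2) = 43/18 conjectured (arXiv:1706.07495
Conj. 1), harmless here since
only lim_{t↓0} J(t) = 0 is used. Items after rev 8: 13 rows — the 6 cruxes that are exactly the
binders of `closes` (K⁺ #2, K⁻ #3; TransportLemma, ModelFacts, CriticalCurveRegular, CurveInvariance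
at ledger rank 9), 5 inert supports outside the cone (PlanarAnchor, PcBounds, AnchorVanishing,
DiagonalOnCurve, CurveTransport stmt-16270) and 2 assembly rows (Assembly = old ten-binder type;
stray Assembly2 stmt-16164 awaiting the gate's multi-assembly autofix).

DEFINITION REQUESTS. None blocking: the family is written over `labelMeasure`, `siteToBoundary`,
`percolatesAt`, `zdGraph`, `criticalProb`,
`criticalProbI`, `theta` (all exist; `lean search --decl` checked) with `let`-bound Θ, θ, p_c, J
inside each item. A Literature
definition `anisotropicBondPercolation (d := 3) p t` + its Russo formula would shorten every
statement (to be requested with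
`ledger workitem add --kind definition --notion AnisotropicBondPercolation --topic
Literature/Probability/Percolation` once the
route is open).

Novelty: Searches (2026-08-16): `lit frontier CriticalPhenomena --since 2022` (30 rows; relevant new:
arXiv:2606.11503 hierarchical
lattices, arXiv:2601.09958 planar end structure — neither transports along a critical curve); `lit
search --hybrid "critical
surface of anisotropic percolation is differentiable"` (8 books: Kesten1982 pp.43–53 planar periodic
critical surfaces, Grimmett1999,
Grimmett2006 — cone-level only); `lit galaxy search "anisotropic bond percolation" --star all` (6
rows; 1 relevant: UFMG
dissertation 2019 'Critical curves in anisotropic percolation on ℤ^{d+s}' = Sanchis–Silva crossover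
bounds arXiv:1706.07495,
read pp.1–22); galaxy "slope of the critical curve percolation" / "exchange rate"+percolation (0
relevant); grep of all 55 Theses
of the sub for anisotrop|exchange|characteristic|critical curve (PercDiodeSteering,
PercSubharmonicSquare, PercLupuEnvironment
mention anisotropy/curves; none transports a jump); cards read in full: exchange-rate-transport
(spine; critic NC 2026-08-16),
annealed-reflection-positivity, scale-concavity-osss-elasticity, and the closed
q-monotone-jump-ising-anchor /
cluster-weight-monotonicity / weakly-coupled-planes-crossover / jump-transfer-traps verdicts;
`ledger negatives` (10).
Nearest prior art found: ChayesSchonmann2000 Thm 1.4 (doi:10.1214/aoap/1019487612: two-sided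
comparability ⇒ Lipschitz critical
curve, never the jump); AizenmanGrimmett1991 / BalisterBollobasRiordan2014 (arXiv:1402.0834: strict
monotonicity of p_c);
GarbanPe  [refs: 10.1214/aoap/1019487612:, 2606.11503, 2601.09958, 1706.07495, 1402.0834, 1008.1378, doi:10.1214/aoap/1019487612, Kesten1982, Grimmett1999, Grimmett2006, ChayesSchonmann2000, AizenmanGrimmett1991, BalisterBollobasRiordan2014]

Barriers (technique_class: exchange-rate-transport, characteristics, usc-anchor): - technique_class: exchange-rate-transport, characteristics, usc-anchor
- Literature.Barriers.CriticalPhenomena.SprinklingRenormalisation: evaded — nothing is renormalised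
and no event is moved across p; only monotonicity of Θ_n along tilted characteristics (all n ≥ m at
once) is transported, and the 'extra δ' is replaced by right-continuity of θ(·,t) at a fixed level
plus usc at the planar point.
- Literature.Barriers.CriticalPhenomena.SlabLimitUniformControl: evaded — the planar end is reached
WITHOUT uniform control near it: J is constant on compact sub-arcs and only lim_{t↓0} J(t) = 0 (usc,
free) is used; conceded that K± are themselves uniformity-in-n hypotheses, but on a bounded local
ratio on compact sub-arcs of (0,1), not on θ near a degenerate end.
- Literature.Barriers.CriticalPhenomena.LongRangeDiscontinuity: consistent delimiter — on
Aizenman–Newman 1/r² families the exchange rate of the marginal long bonds diverges like log n, K±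
fail, and the jump indeed varies along mixed curves; the mechanism refuses to transport exactly
where jumps live.
- Literature.Barriers.CriticalPhenomena.TreesPercolatingAtCriticality: consistent delimiter —
growth-compensated trees and the DGT book lattice (arXiv:2011.04644) carry genuine jumps; there the
transport hypotheses must and do fail (shock/cusp of a_n), which is the falsifiable signature the
card's jobs measure.
- Literature.Barriers.CriticalPhenomena.RandomClusterFirstOrder: not on this arc (q = 1 throughout);
for the FK arc

History (route lifecycle, newest last):
- 2026-08-22T05:40:28Z · LINT AUTOFIX route.multi-assembly: kept Assembly, dropped Assembly2 (gate:hygiene)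

sub-problem: PercolationContinuityZ3 · status: open · opened planner-plan-novel-CriticalPhenomena-Percolatio-701f9421-v2-g3-0 2026-08-16T17:39:42Z · rev 11 · ledger route-CriticalPhenomena-PercExchangeRateTransport
GENERATED by the gate from the ledger (D-0016/17). Provers cite these decls: `theorem foo : Summit.CriticalPhenomena.PercolationContinuityZ3.Theses.PercExchangeRateTransport.<Decl> := …` in Summits/CriticalPhenomena/PercolationContinuityZ3/Theorems/<Name>.lean.
-/

namespace Summit.CriticalPhenomena.PercolationContinuityZ3.Theses.PercExchangeRateTransport

open scoped BigOperators Topology Manifold Classical MeasureTheory ProbabilityTheory Matrix InnerProductSpace ComplexConjugate ContinuousMap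
open Filter Set Function TopologicalSpace MeasureTheory

attribute [summit_statement] _root_.PercolationContinuityZ3

/-- item stmt-CriticalPhenomena-16061 · crux · rank 2 · open · by planner
why it might fail: it is a ratio-limit theorem for pivotal intensities UNIFORM through the critical window from above, with no RSW/quasi-multiplicativity in 3D; it may be as hard as the conjunct, and a jump world would put its fan exactly here.
sources: GarbanPeteSchramm2013Pivotal, AizenmanGrimmett1991, ChayesSchonmann2000, GeorgakopoulosPanagiotis2019, doi:10.1103/PhysRevB.27.4394, arXiv:1706.07495
[crux] K⁺ — for every compact sub-arc [lo,hi] ⊂ (0,1) there are ρ > 0, L and a field a⁺, continuous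
on the closed supercritical collar {t ∈ [lo,hi], p_c(t) ≤ p ≤ p_c(t)+ρ} and L-Lipschitz in p there,
such that for every η > 0 and all n ≥ m(η): |∂_tΘ_n − a⁺ ∂_pΘ_n| ≤ η ∂_pΘ_n on that collar (uniform
convergence of the finite-volume exchange rate, critical window included; card K1, supercritical
half + its regularity). [difficulty: open-problem] -/
@[route_item "route-CriticalPhenomena-PercExchangeRateTransport"]
def SupercritExchangeUniformity : Prop :=
  let μ := Literature.Probability.Percolation.labelMeasure (Literature.Probability.LatticeModels.Site 3); let vert : Sym2 (Literature.Probability.LatticeModels.Site 3) → Prop := fun e => ∃ x : Literature.Probability.LatticeModels.Site 3, e = s(x, x + Pi.single (2 : Fin 3) 1); let cfg : ℝ → ℝ → (Sym2 (Literature.Probability.LatticeModels.Site 3) → ℝ) → Set (Sym2 (Literature.Probability.LatticeModels.Site 3)) := fun p t U => {e | e ∈ (Literature.Probability.LatticeModels.zdGraph 3).edgeSet ∧ ((vert e ∧ U e ≤ t) ∨ (¬ vert e ∧ U e ≤ p))}; let Θ : ℕ → ℝ → ℝ → ℝ := fun n p t => μ.real {U | cfg p t U ∈ Literature.Probability.Percolation.siteToBoundary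 3 n}; let θ : ℝ → ℝ → ℝ := fun p t => μ.real {U | cfg p t U ∈ Literature.Probability.Percolation.percolatesAt (0 : Literature.Probability.LatticeModels.Site 3)}; let pc : ℝ → ℝ := fun t => sInf ({p : ℝ | 0 ≤ p ∧ p ≤ 1 ∧ 0 < θ p t} ∪ {1}); ∀ lo hi : ℝ, 0 < lo → lo < hi → hi < 1 → ∃ ρ > (0 : ℝ), ∃ L : ℝ, ∃ a : ℝ → ℝ → ℝ, ContinuousOn (fun x : ℝ × ℝ => a x.1 x.2) {x : ℝ × ℝ | x.2 ∈ Set.Icc lo hi ∧ pc x.2 ≤ x.1 ∧ x.1 ≤ pc x.2 + ρ} ∧ (∀ t ∈ Set.Icc lo hi, ∀ p q : ℝ, pc t ≤ p → p ≤ pc t + ρ → pc t ≤ q → q ≤ pc t + ρ → |a p t - a q t| ≤ L * |p - q|) ∧ ∀ η > (0 : ℝ), ∃ m : ℕ, ∀ n ≥ m, ∀ t ∈ Set.Icc lo hi, ∀ p : ℝ, pc t ≤ p → p ≤ pc t + ρ → |deriv (fun s => Θ n p s) t - a p t * deriv (fun q => Θ n q t) p| ≤ η * deriv (fun q => Θ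 n q t) p

/-- item stmt-CriticalPhenomena-16062 · crux · rank 3 · open · by planner
why it might fail: needs the window ratio limit from below AND that the crossover to the Ornstein–Zernike string regime deviates from σ(t) by o(1) as p↑p_c(t) uniformly in n (face selection makes the deviation O(dist), direction-dependent); unproved even in d=2.
sources: CampaninoIoffeVelenik2008, GarbanPeteSchramm2013Pivotal, AizenmanGrimmett1991, Grimmett1999, arXiv:0712.3412
[crux] K⁻ — for every compact sub-arc [lo,hi] ⊂ (0,1) there is a continuous σ : [lo,hi] → ℝ (the
slope the subcritical phase measures; K⁺ ∧ K⁻ force σ(t) = a⁺(p_c(t),t) = −p_c′(t)) such that for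
every η > 0 there are δ > 0 and m with |∂_tΘ_n(p,t) − σ(t) ∂_pΘ_n(p,t)| ≤ η ∂_pΘ_n(p,t) whenever n ≥
m, t ∈ [lo,hi] and p_c(t) − δ ≤ p ≤ p_c(t) (card K1, subcritical half, LOCALISED to a δ(η)-strip: it
only pins the slope of the curve, so neither a field off the curve nor a Lipschitz clause is asked
for). [difficulty: open-problem] -/
@[route_item "route-CriticalPhenomena-PercExchangeRateTransport"]
def SubcritExchangeUniformity : Prop :=
  let μ := Literature.Probability.Percolation.labelMeasure (Literature.Probability.LatticeModels.Site 3); let vert : Sym2 (Literature.Probability.LatticeModels.Site 3) → Prop := fun e => ∃ x : Literature.Probability.LatticeModels.Site 3, e = s(x, x + Pi.single (2 : Fin 3) 1); let cfg : ℝ → ℝ → (Sym2 (Literature.Probability.LatticeModels.Site 3) → ℝ) → Set (Sym2 (Literature.Probability.LatticeModels.Site 3)) := fun p t U => {e | e ∈ (Literature.Probability.LatticeModels.zdGraph 3).edgeSet ∧ ((vert e ∧ U e ≤ t) ∨ (¬ vert e ∧ U e ≤ p))}; let Θ : ℕ → ℝ → ℝ → ℝ := fun n p t => μ.real {U | cfg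 p t U ∈ Literature.Probability.Percolation.siteToBoundary 3 n}; let θ : ℝ → ℝ → ℝ := fun p t => μ.real {U | cfg p t U ∈ Literature.Probability.Percolation.percolatesAt (0 : Literature.Probability.LatticeModels.Site 3)}; let pc : ℝ → ℝ := fun t => sInf ({p : ℝ | 0 ≤ p ∧ p ≤ 1 ∧ 0 < θ p t} ∪ {1}); ∀ lo hi : ℝ, 0 < lo → lo < hi → hi < 1 → ∃ σ : ℝ → ℝ, ContinuousOn σ (Set.Icc lo hi) ∧ ∀ η > (0 : ℝ), ∃ δ > (0 : ℝ), ∃ m : ℕ, ∀ n ≥ m, ∀ t ∈ Set.Icc lo hi, ∀ p : ℝ, pc t - δ ≤ p → p ≤ pc t → |deriv (fun s => Θ n p s) t - σ t * deriv (fun q => Θ n q t) p| ≤ η * deriv (fun q => Θ n q t) p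

/-- item stmt-CriticalPhenomena-16063 · crux · rank 9 · closed · proved by Summit.CriticalPhenomena.PercolationContinuityZ3.Theorems.percExchangeRateTransportTransportLemma_proof @ be213a5e984f (prover) · by planner
why it might fail: only AS TYPED — an abstract ∀-statement over (Θ, pc, a) can hide a quantifier or junk-value slip (one was caught before open: levels t outside (0,1) make `deriv` vacuous); the mathematics is a three-page Euler-polygon + discrete-Grönwall argument.
sources: card:exchange-rate-transport, Grimmett1999, ChayesSchonmann2000
[support] the abstract transport lemma (real analysis, percolation-free): for C¹ functions Θ_n on
the open unit square, nondecreasing in p and t, nonincreasing in n, nonnegative, with Θ_∞ = inf_n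
Θ_n having a continuous threshold curve pc on [lo,hi] ⊂ (0,1) whose ρ-collar lies inside the square,
a field a continuous on the two-sided ρ-collar and L-Lipschitz in p on its right half, and for every
η > 0 the exchange-rate inequality |∂_tΘ_n − a ∂_pΘ_n| ≤ η ∂_pΘ_n for n ≥ m(η) on {p_c(t) − δ(η) ≤ p
≤ p_c(t) + ρ} (full right collar, δ(η)-strip on the left): then t ↦ Θ_∞(pc t, t) is constant on
[lo,hi]. Proof = pinching (pc ∈ C¹, pc′ = −a∘curve) + Euler polygons with slopes a(vertex) ± η +
discrete Grönwall + right-continuity of Θ_∞(·,t) at fixed t (NOTES.md §Transport proof).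
[difficulty: M] -/
@[route_item "route-CriticalPhenomena-PercExchangeRateTransport"]
def TransportLemma : Prop :=
  ∀ (Θ : ℕ → ℝ → ℝ → ℝ) (pc : ℝ → ℝ) (a : ℝ → ℝ → ℝ) (lo hi ρ L : ℝ), 0 < lo → lo < hi → hi < 1 → 0 < ρ → (∀ n, ContDiffOn ℝ 1 (fun x : ℝ × ℝ => Θ n x.1 x.2) (Set.Ioo 0 1 ×ˢ Set.Ioo 0 1)) → (∀ n t, Monotone (fun p => Θ n p t)) → (∀ n p, Monotone (fun t => Θ n p t)) → (∀ p t, Antitone (fun n => Θ n p t)) → (∀ n p t, 0 ≤ Θ n p t) → ContinuousOn pc (Set.Icc lo hi) → (∀ t ∈ Set.Icc lo hi, ρ < pc t ∧ pc t + ρ < 1) → (∀ t ∈ Set.Icc lo hi, ∀ p : ℝ, (p < pc t → (⨅ n, Θ n p t) = 0) ∧ (pc t < p → 0 < ⨅ n, Θ n p t)) → ContinuousOn (fun x : ℝ × ℝ => a x.1 x.2) {x : ℝ × ℝ | x.2 ∈ Set.Icc lo hi ∧ |x.1 - pc x.2| ≤ ρ} → (∀ t ∈ Set.Icc lo hi,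 ∀ p q : ℝ, pc t ≤ p → p ≤ pc t + ρ → pc t ≤ q → q ≤ pc t + ρ → |a p t - a q t| ≤ L * |p - q|) → (∀ η > (0 : ℝ), ∃ δ > (0 : ℝ), ∃ m : ℕ, ∀ n ≥ m, ∀ t ∈ Set.Icc lo hi, ∀ p : ℝ, pc t - δ ≤ p → p ≤ pc t + ρ → |deriv (fun s => Θ n p s) t - a p t * deriv (fun q => Θ n q t) p| ≤ η * deriv (fun q => Θ n q t) p) → ∀ t ∈ Set.Icc lo hi, (⨅ n, Θ n (pc t) t) = ⨅ n, Θ n (pc hi) hi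

/-- item stmt-CriticalPhenomena-16064 · crux · rank 9 · closed · proved by Summit.CriticalPhenomena.PercolationContinuityZ3.Theorems.ModelFacts.modelFacts_proof @ e269985bf5ac (prover) · by planner
why it might fail: only as typed: `Measure.real` of the label events (measurability must be shown, not assumed), strict positivity of ∂_pΘ_n needs n ≥ 1 and the open square, and the planar end is an a.s. identification (U_e ≤ 0 has probability 0) — standard but unformalised.
sources: Grimmett1999, Literature.Probability.Percolation.map_configOfLabels, Literature.Probability.Percolation.ProdBernoulliRusso
[support] bookkeeping for the label-coupled anisotropic family: each Θ_n is continuous on ℝ², C¹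
(indeed polynomial) on the open square, nondecreasing in p and in t, nonincreasing in n, valued in
[0,1]; θ = inf_n Θ_n (continuity from above: ∩_n {0 ↔ ∂Λ_n in Λ_n} = {|C(0)| = ∞}); ∂_pΘ_n > 0 on
the open square for n ≥ 1 (Russo: the straight x-path is pivotal); the diagonal t = p is bond
percolation on ℤ³ (`map_configOfLabels_holds`) and t = 0 is a.s. bond percolation on the plane ℤ² ×
{0}. [difficulty: L] -/
@[route_item "route-CriticalPhenomena-PercExchangeRateTransport"]
def ModelFacts : Prop :=
  let μ := Literature.Probability.Percolation.labelMeasure (Literature.Probability.LatticeModels.Site 3); let vert : Sym2 (Literature.Probability.LatticeModels.Site 3) → Prop := fun e => ∃ x : Literature.Probability.LatticeModels.Site 3, e = s(x, x + Pi.single (2 : Fin 3) 1); let cfg : ℝ → ℝ → (Sym2 (Literature.Probability.LatticeModels.Site 3) → ℝ) → Set (Sym2 (Literature.Probability.LatticeModels.Site 3)) := fun p t U => {e | e ∈ (Literature.Probability.LatticeModels.zdGraph 3).edgeSet ∧ ((vert e ∧ U e ≤ t) ∨ (¬ vert e ∧ U e ≤ p))}; let Θ : ℕ → ℝ → ℝ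 → ℝ := fun n p t => μ.real {U | cfg p t U ∈ Literature.Probability.Percolation.siteToBoundary 3 n}; let θ : ℝ → ℝ → ℝ := fun p t => μ.real {U | cfg p t U ∈ Literature.Probability.Percolation.percolatesAt (0 : Literature.Probability.LatticeModels.Site 3)}; (∀ n, Continuous (fun x : ℝ × ℝ => Θ n x.1 x.2)) ∧ (∀ n, ContDiffOn ℝ 1 (fun x : ℝ × ℝ => Θ n x.1 x.2) (Set.Ioo 0 1 ×ˢ Set.Ioo 0 1)) ∧ (∀ n t, Monotone (fun p => Θ n p t)) ∧ (∀ n p, Monotone (fun t => Θ n p t)) ∧ (∀ p t, Antitone (fun n => Θ n p t)) ∧ (∀ n p t, 0 ≤ Θ n p t ∧ Θ n p t ≤ 1) ∧ (∀ p t, θ p t = ⨅ n, Θ n p t) ∧ (∀ n, 1 ≤ n → ∀ p ∈ Set.Ioo (0 : ℝ) 1, ∀ t ∈ Set.Ioo (0 : ℝ) 1, 0 < deriv (fun q => Θ n q t) p) ∧ (∀ p : unitInterval, θ p p = Literature.Probability.Percolation.theta (Literature.Probability.LatticeModels.zdGraph 3) 0 p) ∧ (∀ p : unitInterval, θ p 0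 = Literature.Probability.Percolation.theta (Literature.Probability.LatticeModels.zdGraph 2) 0 p)

/-- item stmt-CriticalPhenomena-16065 · crux · rank 9 · closed · proved by Summit.CriticalPhenomena.PercolationContinuityZ3.Cruxes.CriticalCurveRegular.Locmod.CriticalCurveRegular_proof @ 6568112a84e0 (prover) · by planner
why it might fail: continuity of the anisotropic critical curve on all of (0,1) is Aizenman–Grimmett folklore, not in print for this family; the comparability constants degenerate as t → 1 (columns of length 1/(1−t)), so local Lipschitz bounds must be re-derived scale by scale there.
sources: ChayesSchonmann2000, AizenmanGrimmett1991, BalisterBollobasRiordan2014, arXiv:1706.07495, Grimmett1999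
[support] the anisotropic critical curve t ↦ p_c(t) is continuous on (0,1) with 0 < p_c(t) < 1
(two-sided Aizenman–Grimmett comparability c ∂_pΘ_n ≤ ∂_tΘ_n ≤ C ∂_pΘ_n on compacts of the open
square gives local Lipschitz continuity exactly as in Chayes–Schonmann's mixed site–bond curve;
p_c(t) ≥ (1−t)/8 by path counting with vertical runs, p_c(t) ≤ p_c(ℤ²) < 1 by monotonicity in t).
[difficulty: L] -/
@[route_item "route-CriticalPhenomena-PercExchangeRateTransport"]
def CriticalCurveRegular : Prop :=
  let μ := Literature.Probability.Percolation.labelMeasure (Literature.Probability.LatticeModels.Site 3); let vert : Sym2 (Literature.Probability.LatticeModels.Site 3) → Prop := fun e => ∃ x : Literature.Probability.LatticeModels.Site 3, e = s(x, x + Pi.single (2 : Fin 3) 1); let cfg : ℝ → ℝ → (Sym2 (Literature.Probability.LatticeModels.Site 3) → ℝ) → Set (Sym2 (Literature.Probability.LatticeModels.Site 3)) := fun p t U => {e | e ∈ (Literature.Probability.LatticeModels.zdGraph 3).edgeSet ∧ ((vert e ∧ U e ≤ t) ∨ (¬ vert e ∧ U e ≤ p))}; let θ : ℝ → ℝ →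 ℝ := fun p t => μ.real {U | cfg p t U ∈ Literature.Probability.Percolation.percolatesAt (0 : Literature.Probability.LatticeModels.Site 3)}; let pc : ℝ → ℝ := fun t => sInf ({p : ℝ | 0 ≤ p ∧ p ≤ 1 ∧ 0 < θ p t} ∪ {1}); ContinuousOn pc (Set.Ioo 0 1) ∧ ∀ t ∈ Set.Ioo (0 : ℝ) 1, 0 < pc t ∧ pc t < 1

/-- item stmt-CriticalPhenomena-16068 · crux · rank 9 · closed · proved by Summit.CriticalPhenomena.PercolationContinuityZ3.Theorems.PercExchangeRateTransportCurveInvariance.curveInvariance_proof @ c483e89f19bc (prover) · by planner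
why it might fail: Instantiation as typed: the glued field a := a⁺ above / σ(t) below the curve is continuous only where ∂_pΘ_n > 0 for some n ≥ m(η); K±'s collar and δ(η)-strip must fit TransportLemma's two-sided ρ-collar after shrinking ρ on [lo,hi]; the threshold property is needed for all real p (sInf ∪ {1}).
sources: card:exchange-rate-transport, ChayesSchonmann2000, Grimmett1999
[support] instantiation: TransportLemma + K⁺ + K⁻ + ModelFacts + CriticalCurveRegular + PcBounds ⇒ J
is constant on every compact sub-arc [lo,hi] ⊂ (0,1) (extend a⁺ below the curve by σ(t); the glued
field is continuous because K⁺ and K⁻ both hold at p = p_c(t) and ∂_pΘ_n > 0 forces a⁺(p_c(t),t) =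
σ(t); shrink ρ into the open square; threshold property of p_c from its sInf definition and θ =
inf_n Θ_n). [difficulty: M] -/
@[route_item "route-CriticalPhenomena-PercExchangeRateTransport"]
def CurveInvariance : Prop :=
  let μ := Literature.Probability.Percolation.labelMeasure (Literature.Probability.LatticeModels.Site 3); let vert : Sym2 (Literature.Probability.LatticeModels.Site 3) → Prop := fun e => ∃ x : Literature.Probability.LatticeModels.Site 3, e = s(x, x + Pi.single (2 : Fin 3) 1); let cfg : ℝ → ℝ → (Sym2 (Literature.Probability.LatticeModels.Site 3) → ℝ) → Set (Sym2 (Literature.Probability.LatticeModels.Site 3)) := fun p t U => {e | e ∈ (Literature.Probability.LatticeModels.zdGraph 3).edgeSet ∧ ((vert e ∧ U e ≤ t) ∨ (¬ vert e ∧ U e ≤ p))}; let θ : ℝ → ℝ → ℝ := fun p t => μ.real {U | cfg p t U ∈ Literature.Probability.Percolation.percolatesAt (0 : Literature.Probability.LatticeModels.Site 3)}; let pc : ℝ → ℝ := fun t => sInf ({p : ℝ | 0 ≤ p ∧ p ≤ 1 ∧ 0 < θ p t} ∪ {1}); let J : ℝ → ℝ := fun t => θ (pc t) t; TransportLemma →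 SupercritExchangeUniformity → SubcritExchangeUniformity → ModelFacts → CriticalCurveRegular → Literature.Probability.Percolation.Grimmett1999_criticalProb_pos_lt_one → ∀ lo hi : ℝ, 0 < lo → lo < hi → hi < 1 → ∀ t ∈ Set.Icc lo hi, J t = J hi

-- TODO item stmt-CriticalPhenomena-16270 · support · rank 4 · open · by planner — BLOCKED: missing decl(s) CriticalCurveRegular, ModelFacts; restate via `ledger route edit` once they land:
--   def CurveTransport : Prop := let μ := Literature.Probability.Percolation.labelMeasure (Literature.Probability.LatticeModels.Site 3); let vert : Sym2 (Literature.Probability.LatticeModels.Site 3) → Prop := fun e => ∃ x : Literature.Probability.LatticeModels.Site 3, e = s(x, x + Pi.single (2 : Fin 3) 1); let cfg : ℝ → ℝ → (Sym2 (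

/-- item stmt-CriticalPhenomena-16066 · support · rank 9 · closed · proved by Summit.CriticalPhenomena.PercolationContinuityZ3.Theorems.PercExchangeRateTransportPlanarAnchor.planarAnchor_proof @ 0cc6ddf447bd (prover) · by planner
sources: Harris1960, KestenCMP1980, Grimmett1999
[support] θ_{ℤ²}(p_c(ℤ²)) = 0 (Harris 1960 + Kesten 1980); in tree as `percolationContinuity_two`
modulo the named facts `kesten_criticalProb_Z2`, `harris_theta_half`. [difficulty: XL] -/
@[route_item "route-CriticalPhenomena-PercExchangeRateTransport"]
def PlanarAnchor : Prop :=
  Literature.Probability.Percolation.PercolationContinuity 2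

/-- item stmt-CriticalPhenomena-16067 · support · rank 9 · closed · proved by Summit.CriticalPhenomena.PercolationContinuityZ3.Theorems.PercExchangeRateTransportPcBounds.pcBounds_proof @ 0cc6ddf447bd (prover) · by planner
sources: Grimmett1999, Literature.Probability.Percolation.Grimmett1999_criticalProb_pos_lt_one
[support] 0 < p_c(ℤ^d) < 1 for d ≥ 2 (Peierls + tree bound); the Literature named fact, used at d =
2 and d = 3 to place the planar anchor and the diagonal point inside the open square. [difficulty:
M] -/
@[route_item "route-CriticalPhenomena-PercExchangeRateTransport"]
def PcBounds : Prop :=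
  Literature.Probability.Percolation.Grimmett1999_criticalProb_pos_lt_one

/-- item stmt-CriticalPhenomena-16069 · support · rank 9 · closed · proved by Summit.CriticalPhenomena.PercolationContinuityZ3.Theorems.PercExchangeRateTransportAnchorVanishing.anchorVanishing_proof @ 9027a12a25f1 (prover) · by planner
sources: Harris1960, KestenCMP1980, arXiv:1706.07495, Grimmett1999
[support] the free anchor: ModelFacts + PcBounds + PercolationContinuity 2 ⇒ J(t) → 0 as t ↓ 0
(p_c(t) ≤ p_c(ℤ²) by monotonicity in t; θ(p_c(ℤ²),t) = inf_n Θ_n(p_c(ℤ²),t) and Θ_n(p_c(ℤ²),0) ↓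
θ_{ℤ²}(p_c(ℤ²)) = 0, so usc in t at the planar point does the rest — no uniformity near the planar
end is used). [difficulty: M] -/
@[route_item "route-CriticalPhenomena-PercExchangeRateTransport"]
def AnchorVanishing : Prop :=
  let μ := Literature.Probability.Percolation.labelMeasure (Literature.Probability.LatticeModels.Site 3); let vert : Sym2 (Literature.Probability.LatticeModels.Site 3) → Prop := fun e => ∃ x : Literature.Probability.LatticeModels.Site 3, e = s(x, x + Pi.single (2 : Fin 3) 1); let cfg : ℝ → ℝ → (Sym2 (Literature.Probability.LatticeModels.Site 3) → ℝ) → Set (Sym2 (Literature.Probability.LatticeModels.Site 3)) := fun p t U => {e | e ∈ (Literature.Probability.LatticeModels.zdGraph 3).edgeSet ∧ ((vert e ∧ U e ≤ t) ∨ (¬ vert e ∧ U e ≤ p))}; let θ : ℝ → ℝ → ℝ := fun p t => μ.real {U | cfg p t U ∈ Literature.Probability.Percolation.percolatesAt (0 : Literature.Probability.LatticeModels.Site 3)}; let pc : ℝ → ℝ := fun t => sInf ({p : ℝ | 0 ≤ p ∧ p ≤ 1 ∧ 0 < θ p t} ∪ {1}); let J : ℝ → ℝ := fun t => θ (pc t)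 t; ModelFacts → Literature.Probability.Percolation.Grimmett1999_criticalProb_pos_lt_one → Literature.Probability.Percolation.PercolationContinuity 2 → ∀ ε > (0 : ℝ), ∃ t₁ > (0 : ℝ), ∀ t : ℝ, 0 < t → t < t₁ → J t ≤ ε

/-- item stmt-CriticalPhenomena-16070 · support · rank 9 · closed · proved by Summit.CriticalPhenomena.PercolationContinuityZ3.Theorems.PercExchangeRateTransportDiagonalOnCurve.diagonalOnCurve_proof @ 9027a12a25f1 (prover) · by planner
sources: Grimmett1999, AizenmanGrimmett1991
[support] the isotropic point is ON the curve: ModelFacts + CriticalCurveRegular + PcBounds ⇒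
p_c(t)|_{t = p_c(ℤ³)} = p_c(ℤ³) and J(p_c(ℤ³)) = θ_{ℤ³}(p_c) (order argument: p_c(t) ≥ t for t <
p_c(ℤ³), ≤ t for t > p_c(ℤ³), continuity of the curve at p_c(ℤ³) ∈ (0,1)). [difficulty: M] -/
@[route_item "route-CriticalPhenomena-PercExchangeRateTransport"]
def DiagonalOnCurve : Prop :=
  let μ := Literature.Probability.Percolation.labelMeasure (Literature.Probability.LatticeModels.Site 3); let vert : Sym2 (Literature.Probability.LatticeModels.Site 3) → Prop := fun e => ∃ x : Literature.Probability.LatticeModels.Site 3, e = s(x, x + Pi.single (2 : Fin 3) 1); let cfg : ℝ → ℝ → (Sym2 (Literature.Probability.LatticeModels.Site 3) → ℝ) → Set (Sym2 (Literature.Probability.LatticeModels.Site 3)) := fun p t U => {e | e ∈ (Literature.Probability.LatticeModels.zdGraph 3).edgeSet ∧ ((vert e ∧ U e ≤ t) ∨ (¬ vert e ∧ U e ≤ p))}; let θ : ℝ → ℝ → ℝ := fun p t => μ.real {U | cfg p t U ∈ Literature.Probability.Percolation.percolatesAt (0 : Literature.Probability.LatticeModels.Site 3)}; let pc : ℝ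 → ℝ := fun t => sInf ({p : ℝ | 0 ≤ p ∧ p ≤ 1 ∧ 0 < θ p t} ∪ {1}); let J : ℝ → ℝ := fun t => θ (pc t) t; ModelFacts → CriticalCurveRegular → Literature.Probability.Percolation.Grimmett1999_criticalProb_pos_lt_one → pc (Literature.Probability.Percolation.criticalProb (Literature.Probability.LatticeModels.zdGraph 3) 0) = Literature.Probability.Percolation.criticalProb (Literature.Probability.LatticeModels.zdGraph 3) 0 ∧ J (Literature.Probability.Percolation.criticalProb (Literature.Probability.LatticeModels.zdGraph 3) 0) = Literature.Probability.Percolation.theta (Literature.Probability.LatticeModels.zdGraph 3) 0 (Literature.Probability.Percolation.criticalProbI 3)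

/-- item stmt-CriticalPhenomena-16071 · assembly · rank 1 · closed · proved by Summit.CriticalPhenomena.PercolationContinuityZ3.Theorems.PercExchangeRateTransportAssembly.assembly_proof @ 1922d85d9809 (prover) · by planner
sources: card:exchange-rate-transport, Grimmett1999
[assembly] SupercritExchangeUniformity → SubcritExchangeUniformity → TransportLemma → ModelFacts →
CriticalCurveRegular → PlanarAnchor → PcBounds → CurveInvariance → AnchorVanishing → DiagonalOnCurve
→ PercolationContinuityZ3; it is literally the type of `closes`, so `theorem Assembly_holds :
Assembly := closes` discharges it (kept as an item because the schema requires exactly one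
assembly). -/
@[route_item "route-CriticalPhenomena-PercExchangeRateTransport"]
def Assembly : Prop :=
  SupercritExchangeUniformity → SubcritExchangeUniformity → TransportLemma → ModelFacts → CriticalCurveRegular → PlanarAnchor → PcBounds → CurveInvariance → AnchorVanishing → DiagonalOnCurve → PercolationContinuityZ3

-- records of items no longer active in this route (dropped / restated):
-- earlier Assembly2 (stmt-CriticalPhenomena-16164, dropped 2026-08-22T05:40:28Z): moot by None — TransportLemma → SupercritExchangeUniformity → SubcritExchangeUniformity → ModelFacts → CriticalCurveRegular → Literature.Probability.Percolation.theta (Literature.Probability.LatticeModels.zdGraph 3) 0 (Literature.Probability.Percolation.criticalProbI 3) ≤ 0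

/-! D-0027 §2.1 — DECIDING THEOREM (planner-authored via `route open/edit --closes-file`; by planner-rbadge-CriticalPhenomena-PercExchangeR-2bd37ac4-0 2026-08-16T18:19:27Z):
its hypotheses are this route's items and its conclusion the sub-problem Statement (glue_lint), and it elaborates with this file. -/

@[closes "route-CriticalPhenomena-PercExchangeRateTransport"] theorem closes (hSup : SupercritExchangeUniformity) (hSub : SubcritExchangeUniformity)
    (hT : TransportLemma) (hMF : ModelFacts) (hCC : CriticalCurveRegular)
    (hCI : CurveInvariance) : PercolationContinuityZ3 := by
  /- (I) The real-variable core, percolation-free: for a family `Θ n p t` of continuous functions,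
     monotone in `p` and `t`, with `θ = ⨅ n Θ n`, threshold curve `pc`, slices `θ p p = th3 p`,
     `θ p 0 = th2 p`, continuity of `pc` on `(0,1)`, invariance of `t ↦ θ (pc t) t` on compact
     sub-arcs (the crux `CurveInvariance` = the abstract `TransportLemma` instantiated, fed with
     `TransportLemma`, K⁺, K⁻, `ModelFacts`, `CriticalCurveRegular` and the tree theorem 0 < p_c < 1), the
     phase structure of `th3`/`th2` around `p₃`/`p₂` and the planar anchor `th2 p₂ = 0`, one gets
     `th3 p₃ = 0`.  Steps: (A) `t ≤ pc t` for `t < p₃`; (B) `pc t ≤ p₃` for `t > p₃`; (C) `pc p₃ = p₃`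
     by continuity; (AV) `θ (pc t) t → 0` as `t ↓ 0` by upper semicontinuity at `(p₂, 0)`
     (the old support items DiagonalOnCurve / AnchorVanishing, now proved here);
     then `J(p₃) = J(hi) = J(lo) < J(p₃)/2`. -/
  have key : ∀ {Θ : ℕ → ℝ → ℝ → ℝ} {θ : ℝ → ℝ → ℝ} {pc : ℝ → ℝ}
      {th3 th2 : unitInterval → ℝ} {p₃ p₂ : ℝ} (hp₃ : p₃ ∈ unitInterval) (hp₂ : p₂ ∈ unitInterval),
      (∀ p t, θ p t = ⨅ n, Θ n p t) →
      (∀ t, pc t = sInf ({p : ℝ | 0 ≤ p ∧ p ≤ 1 ∧ 0 < θ p t} ∪ {1})) →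
      (∀ n, Continuous (fun x : ℝ × ℝ => Θ n x.1 x.2)) →
      (∀ n t, Monotone (fun p => Θ n p t)) →
      (∀ n p, Monotone (fun t => Θ n p t)) →
      (∀ n p t, 0 ≤ Θ n p t) →
      (∀ p : unitInterval, θ p p = th3 p) →
      (∀ p : unitInterval, θ p 0 = th2 p) →
      ContinuousOn pc (Set.Ioo 0 1) →
      (∀ lo hi : ℝ, 0 < lo → lo < hi → hi < 1 → ∀ t ∈ Set.Icc lo hi, θ (pc t) t = θ (pc hi) hi) →
      0 < p₃ → p₃ < 1 → 0 < p₂ → p₂ < 1 →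
      (∀ p : unitInterval, (p : ℝ) < p₃ → th3 p = 0) →
      (∀ p : unitInterval, p₃ < (p : ℝ) → 0 < th3 p) →
      (∀ p : unitInterval, p₂ < (p : ℝ) → 0 < th2 p) →
      th2 ⟨p₂, hp₂⟩ = 0 → th3 ⟨p₃, hp₃⟩ = 0 := by
    intro Θ θ pc th3 th2 p₃ p₂ hp₃ hp₂ hinf hpc hcont hmp hmt hnn hdiag hplane hpcc hJ h3l h3u h2l h2u
      h3zero h3pos h2pos h2crit
    -- a small chooser of margins
    have hpick : ∀ a b c : ℝ, 0 < a → 0 < b → 0 < c →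
        ∃ s, 0 < s ∧ s < a ∧ s < b ∧ s ≤ c / 2 := fun a b c ha hb hc => by
      refine ⟨min a (min b c) / 2, ?_, ?_, ?_, ?_⟩
      · have : 0 < min a (min b c) := lt_min ha (lt_min hb hc); linarith
      · have : min a (min b c) ≤ a := min_le_left _ _; linarith
      · have : min a (min b c) ≤ b := (min_le_right _ _).trans (min_le_left _ _); linarith
      · have : min a (min b c) ≤ c := (min_le_right _ _).trans (min_le_right _ _); linarith
    -- basic facts about θ = inf_n Θ_n
    have hbdd : ∀ p t, BddBelow (Set.range fun n => Θ n p t) := fun p t =>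
      ⟨0, by rintro _ ⟨n, rfl⟩; exact hnn n p t⟩
    have hθ_le : ∀ n p t, θ p t ≤ Θ n p t := fun n p t => by
      rw [hinf]; exact ciInf_le (hbdd p t) n
    have hθ_nn : ∀ p t, 0 ≤ θ p t := fun p t => by
      rw [hinf]; exact le_ciInf fun n => hnn n p t
    have hθ_mp : ∀ t p q, p ≤ q → θ p t ≤ θ q t := fun t p q hpq => by
      rw [hinf, hinf]; exact ciInf_mono (hbdd p t) fun n => hmp n t hpq
    have hθ_mt : ∀ p s t, s ≤ t → θ p s ≤ θ p t := fun p s t hst => by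
      rw [hinf, hinf]; exact ciInf_mono (hbdd p s) fun n => hmt n p hst
    -- the set whose infimum is pc t
    have hS_ne : ∀ t, ({p : ℝ | 0 ≤ p ∧ p ≤ 1 ∧ 0 < θ p t} ∪ {1}).Nonempty := fun t =>
      ⟨1, Or.inr rfl⟩
    have hS_bdd : ∀ t, BddBelow ({p : ℝ | 0 ≤ p ∧ p ≤ 1 ∧ 0 < θ p t} ∪ {1}) := fun t =>
      ⟨0, by
        rintro p (⟨hp, -⟩ | hp)
        · exact hp
        · rw [Set.mem_singleton_iff] at hp; rw [hp]; exact zero_le_one⟩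
    have hpc_le : ∀ t q, 0 ≤ q → q ≤ 1 → 0 < θ q t → pc t ≤ q := fun t q h0 h1 hpos => by
      rw [hpc]; exact csInf_le (hS_bdd t) (Or.inl ⟨h0, h1, hpos⟩)
    have hle_pc : ∀ t c, c ≤ 1 → (∀ p, 0 ≤ p → p < c → θ p t ≤ 0) → c ≤ pc t :=
        fun t c hc1 hzero => by
      rw [hpc]
      refine le_csInf (hS_ne t) ?_
      rintro p (⟨hp0, -, hpos⟩ | hp)
      · by_contra hlt
        exact absurd (hzero p hp0 (not_le.mp hlt)) (not_le.mpr hpos)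
      · rw [Set.mem_singleton_iff] at hp; rw [hp]; exact hc1
    -- (A) below the isotropic critical point the curve lies above the diagonal
    have hA : ∀ t, 0 < t → t < p₃ → t ≤ pc t := fun t ht0 ht3 => by
      have ht1 : t ≤ 1 := (ht3.trans h3u).le
      refine hle_pc t t ht1 fun p hp0 hpt => ?_
      have e : θ t t = th3 ⟨t, ht0.le, ht1⟩ := hdiag ⟨t, ht0.le, ht1⟩
      have hz : th3 ⟨t, ht0.le, ht1⟩ = 0 := h3zero ⟨t, ht0.le, ht1⟩ ht3
      calc θ p t ≤ θ t t := hθ_mp t p t hpt.le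
        _ = 0 := by rw [e, hz]
    -- (B) above it the curve lies below the level p₃
    have hB : ∀ t, p₃ < t → t < 1 → pc t ≤ p₃ := fun t ht3 ht1 => by
      by_contra hcon'
      have hcon := not_le.mp hcon'
      obtain ⟨q, hq3, hqpc, hqt⟩ : ∃ q, p₃ < q ∧ q < pc t ∧ q < t :=
        ⟨min ((p₃ + pc t) / 2) ((p₃ + t) / 2), lt_min (by linarith) (by linarith),
          (min_le_left _ _).trans_lt (by linarith), (min_le_right _ _).trans_lt (by linarith)⟩
      have hq0 : 0 ≤ q := (h3l.trans hq3).le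
      have hq1 : q ≤ 1 := (hqt.trans ht1).le
      have hpos : 0 < θ q t := by
        have e : θ q q = th3 ⟨q, hq0, hq1⟩ := hdiag ⟨q, hq0, hq1⟩
        have hp : 0 < th3 ⟨q, hq0, hq1⟩ := h3pos ⟨q, hq0, hq1⟩ hq3
        calc (0 : ℝ) < θ q q := by rw [e]; exact hp
          _ ≤ θ q t := hθ_mt q q t hqt.le
      exact absurd (hpc_le t q hq0 hq1 hpos) (not_le.mpr hqpc)
    -- (C) continuity of the curve at p₃ pins the isotropic point onto the curve
    have hC : pc p₃ = p₃ := by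
      have hcw : ContinuousWithinAt pc (Set.Ioo 0 1) p₃ := hpcc p₃ ⟨h3l, h3u⟩
      rw [Metric.continuousWithinAt_iff] at hcw
      apply le_antisymm
      · by_contra hcon'
        have hcon := not_le.mp hcon'
        obtain ⟨δ, hδ, hδ'⟩ := hcw ((pc p₃ - p₃) / 2) (by linarith)
        obtain ⟨s, hs0, hsδ, hs1, -⟩ := hpick δ (1 - p₃) 1 hδ (by linarith) one_pos
        have hmem : p₃ + s ∈ Set.Ioo (0 : ℝ) 1 := ⟨by linarith, by linarith⟩
        have hdist : dist (p₃ + s) p₃ < δ := by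
          rw [Real.dist_eq, show p₃ + s - p₃ = s by ring, abs_of_pos hs0]; exact hsδ
        have h := hδ' hmem hdist
        rw [Real.dist_eq] at h
        have hBt := hB (p₃ + s) (by linarith) (by linarith)
        have h' := (abs_sub_lt_iff.mp h).2
        linarith
      · by_contra hcon'
        have hcon := not_le.mp hcon'
        obtain ⟨δ, hδ, hδ'⟩ := hcw ((p₃ - pc p₃) / 2) (by linarith)
        obtain ⟨s, hs0, hsδ, hs3, hsε⟩ := hpick δ p₃ (p₃ - pc p₃) hδ h3l (by linarith)
        have hmem : p₃ - s ∈ Set.Ioo (0 : ℝ) 1 := ⟨by linarith, by linarith⟩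
        have hdist : dist (p₃ - s) p₃ < δ := by
          rw [Real.dist_eq, show p₃ - s - p₃ = -s by ring, abs_neg, abs_of_pos hs0]; exact hsδ
        have h := hδ' hmem hdist
        rw [Real.dist_eq] at h
        have hAt := hA (p₃ - s) (by linarith) (by linarith)
        have h' := (abs_sub_lt_iff.mp h).1
        linarith
    -- (AV) the planar anchor: J(t) → 0 as t ↓ 0, by upper semicontinuity at (p_c(ℤ²), 0)
    have hAV : ∀ ε, 0 < ε → ∃ t₁, 0 < t₁ ∧ ∀ t, 0 < t → t < t₁ → θ (pc t) t < ε := fun ε hε => by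
      have h0 : θ p₂ 0 = 0 := by
        have e : θ p₂ 0 = th2 ⟨p₂, hp₂⟩ := hplane ⟨p₂, hp₂⟩
        rw [e]; exact h2crit
      have hlt : (⨅ n, Θ n p₂ 0) < ε := by rw [← hinf, h0]; exact hε
      obtain ⟨n₀, hn₀⟩ := exists_lt_of_ciInf_lt hlt
      have hopen : IsOpen {x : ℝ × ℝ | Θ n₀ x.1 x.2 < ε} := isOpen_lt (hcont n₀) continuous_const
      obtain ⟨r, hr, hball⟩ := Metric.isOpen_iff.mp hopen (p₂, 0) hn₀
      obtain ⟨s, hs0, hsr, hs1, -⟩ := hpick r (1 - p₂) 1 hr (by linarith) one_pos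
      refine ⟨s, hs0, fun t ht0 hts => ?_⟩
      have hq0 : 0 ≤ p₂ + s := by linarith
      have hq1 : p₂ + s ≤ 1 := by linarith
      have hΘ : Θ n₀ (p₂ + s) t < ε := by
        have hmem : ((p₂ + s, t) : ℝ × ℝ) ∈ Metric.ball ((p₂, 0) : ℝ × ℝ) r := by
          rw [Metric.mem_ball, Prod.dist_eq, Real.dist_eq, Real.dist_eq,
            show p₂ + s - p₂ = s by ring, sub_zero, abs_of_pos hs0, abs_of_pos ht0]
          exact max_lt hsr (hts.trans hsr)
        exact hball hmem
      have hθq : 0 < θ (p₂ + s) t := by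
        have e : θ (p₂ + s) 0 = th2 ⟨p₂ + s, hq0, hq1⟩ := hplane ⟨p₂ + s, hq0, hq1⟩
        have hp : 0 < th2 ⟨p₂ + s, hq0, hq1⟩ :=
          h2pos ⟨p₂ + s, hq0, hq1⟩ (show p₂ < p₂ + s by linarith)
        calc (0 : ℝ) < θ (p₂ + s) 0 := by rw [e]; exact hp
          _ ≤ θ (p₂ + s) t := hθ_mt _ 0 t ht0.le
      calc θ (pc t) t ≤ θ (p₂ + s) t := hθ_mp t _ _ (hpc_le t _ hq0 hq1 hθq)
        _ ≤ Θ n₀ (p₂ + s) t := hθ_le n₀ _ t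
        _ < ε := hΘ
    -- assembly: J(p₃) = θ_{ℤ³}(p_c); if it were positive, transport it to a small t and contradict (AV)
    have hJ3 : θ (pc p₃) p₃ = th3 ⟨p₃, hp₃⟩ := by rw [hC]; exact hdiag ⟨p₃, hp₃⟩
    rw [← hJ3]
    refine le_antisymm (not_lt.mp fun hpos => ?_) (hθ_nn _ _)
    obtain ⟨t₁, ht₁, hsmall⟩ := hAV (θ (pc p₃) p₃ / 2) (half_pos hpos)
    obtain ⟨lo, hlo0, hlot, hlo3, -⟩ := hpick t₁ p₃ 1 ht₁ h3l one_pos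
    have hlohi : lo < (p₃ + 1) / 2 := by linarith
    have hhi : (p₃ + 1) / 2 < 1 := by linarith
    have e1 := hJ lo ((p₃ + 1) / 2) hlo0 hlohi hhi p₃ ⟨hlo3.le, by linarith⟩
    have e2 := hJ lo ((p₃ + 1) / 2) hlo0 hlohi hhi lo ⟨le_rfl, hlohi.le⟩
    have e3 := hsmall lo hlo0 hlot
    linarith
  /- (II) Instantiation: the label-coupled anisotropic family on ℤ²×ℤ (Θ, θ, pc are read off the
     items by unification), the tree theorems `0 < p_c(ℤ^d) < 1` (Grimmett 1999 Thm (1.10),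
     `Grimmett1999_criticalProb_pos_lt_one_holds`) and `θ_{ℤ²}(p_c) = 0` (Harris 1960 + Kesten 1980,
     `percolationContinuity_two kesten_criticalProb_Z2_holds harris_theta_half_holds`), `θ = 0`
     below / `θ > 0` above `p_c`, and the six cruxes (K⁺, K⁻, `TransportLemma` enter through
     `CurveInvariance`). -/
  show Literature.Probability.Percolation.theta (Literature.Probability.LatticeModels.zdGraph 3) 0
      (Literature.Probability.Percolation.criticalProbI 3) = 0
  have hJ := hCI hT hSup hSub hMF hCC
    Literature.Probability.Percolation.Grimmett1999_criticalProb_pos_lt_one_holds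
  obtain ⟨h1, -, h3, h4, -, h6, h7, -, h9, h10⟩ := hMF
  obtain ⟨hcc1, -⟩ := hCC
  have h3b := Literature.Probability.Percolation.Grimmett1999_criticalProb_pos_lt_one_holds 3 (by norm_num)
  have h2b := Literature.Probability.Percolation.Grimmett1999_criticalProb_pos_lt_one_holds 2 (by norm_num)
  have hPA : Literature.Probability.Percolation.PercolationContinuity 2 :=
    Literature.Probability.Percolation.percolationContinuity_two
      Literature.Probability.Percolation.kesten_criticalProb_Z2_holds
      Literature.Probability.Percolation.harris_theta_half_holds
  exact key
    (th3 := Literature.Probability.Percolation.theta (Literature.Probability.LatticeModels.zdGraph 3) 0)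
    (th2 := Literature.Probability.Percolation.theta (Literature.Probability.LatticeModels.zdGraph 2) 0)
    (Literature.Probability.Percolation.criticalProb_mem_Icc
      (Literature.Probability.LatticeModels.zdGraph 3) 0)
    (Literature.Probability.Percolation.criticalProb_mem_Icc
      (Literature.Probability.LatticeModels.zdGraph 2) 0)
    h7 (fun _ => rfl) h1 h3 h4 (fun n p t => (h6 n p t).1) h9 h10 hcc1 hJ h3b.1 h3b.2 h2b.1 h2b.2
    (fun p hp => Literature.Probability.Percolation.theta_eq_zero_of_lt_criticalProb_holds _ _ p hp)
    (fun p hp => Literature.Probability.Percolation.theta_pos_of_criticalProb_lt_holds _ _ p hp)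
    (fun p hp => Literature.Probability.Percolation.theta_pos_of_criticalProb_lt_holds _ _ p hp)
    hPA

end Summit.CriticalPhenomena.PercolationContinuityZ3.Theses.PercExchangeRateTransport
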